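import Literature.MathematicalPhysics.QuantumFieldTheory.VortexTwistCohomology
import Literature.MathematicalPhysics.QuantumFieldTheory.ConstructiveQFTWave0Proofs
import HarnessLib

/-!
# The character ("polymer activity") expansion of Tomboulis's twisted `SU(2)` partition functions on
# the one-character ray, and the top-coefficient sign rule

Topic `Literature/MathematicalPhysics/QuantumFieldTheory`, vocabulary of `TomboulisVortexDecimation.lean`
(namespace `Tomboulis2007`: `SU2`, `su2Char`, `plaqFn`, `plaqFnTwist`, `torusZ`, `torusZtw`) and of
`ConstructiveQFTWave0.lean` (`GaugeConfig`, `Plaquette`, `plaquetteHolonomy`, `haarProbability`).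
Theorems, plus two auxiliary definitions (`plaqChar`, `charMoment`); no new fact.

E. T. Tomboulis, arXiv:0707.2179 [Tomboulis2007Confinement], §6, eqs. (6.2)–(6.4): the partition
functions are expanded in the plaquette "activities" `g_p(U) = Σ_{j≠0} d_j c_j χ_j(U_p)`,
`z(Y) = ∫ ∏_{b∈Y} dU_b ∏_{p∈Y} g_p(U)` ((6.2)–(6.3)), and "in the case of `Z⁻`, the presence of the flux
enters the activities through the replacement (4.4)" (text after (6.4)), i.e. `c_j ↦ (-1)^{2j} c_j` on the
twisted plaquettes. On the ONE-CHARACTER RAY (spin cut-off `J = 1`: `f(U) = 1 + 2 c_{1/2} χ_{1/2}(U)`,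
`f⁻(U) = 1 - 2 c_{1/2} χ_{1/2}(U)`) this is the finite expansion, proved here for every torus `(ℤ/Lℤ)^d`,
every real `c_{1/2}` and every twist set `V`:

  `Z⁻_V = Σ_{S ⊆ plaquettes} (2 c_{1/2})^{|S|} (-1)^{|S ∩ V|} I(S)`,   `I(S) = ∫ ∏_{p ∈ S} χ_{1/2}(U_p) ∏_b dU_b`

(`torusZtw_one_eq_sum`, `torusZ_one_eq_sum`; `charMoment S = I(S)` is the Haar moment of the support `S`,
the unnormalised activity of (6.2) summed over all — not only connected — plaquette sets). Expanding the
product is `Finset.prod_one_add`; exchanging the finite sum with the Haar integral uses that every term is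
bounded (`|χ_{1/2}| ≤ 2`) and measurable (`WilsonRP.measurable_plaqRe` of `ConstructiveQFTWave0Proofs`).

Consequence — **the top-coefficient sign rule** of the exact small-volume census (cell pub-ymgap,
lit/LIT2-TOMBOULIS-ITOSEILER.md §I (P4): "`z⁻_F = (-1)^{|V|} z_F`"): the only support of full size is the
set of ALL `F` plaquettes, on which the twist sign is `(-1)^{|V|}`, so
`Z⁻_V - (-1)^{|V|} Z` is a combination of the moments of the PROPER supports only, i.e. has degree `< F`
in `c_{1/2}` (`torusZtw_one_sub_sign_mul_torusZ`). Together with the centre symmetry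
(`VortexTwistSignFlip.lean`, `VortexTwistCohomology.lean`) this is the "law" half of the census parity
structure. **Revision 2 (append-only)** adds the SUPPORT RULE (census identity (P3), "supports are
mod-2 cycles"): by the change of variables `U_b ↦ -U_b` of `VortexTwistCohomology.lean` the product
`∏_{p∈S} χ_{1/2}(U_p)` picks up `(-1)^{|S ∩ δE|}` (`prod_plaqChar_flipLinks`), so `I(S) = 0` whenever `S`
meets some coboundary oddly (`charMoment_eq_zero_of_odd_inter_coboundary`,
`even_inter_coboundary_of_charMoment_ne_zero`) — only closed surfaces (no free bond, every bond in an
even number of plaquettes of `S`) contribute, which is the enumeration domain of the exact engines. The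
signs of the coefficients and the location of sign changes are NOT addressed here.

HONEST FRAMING: algebraic identities between finite-dimensional Haar integrals; nothing about signs,
monotonicity, (5.15), confinement or any limit.

## References
* [Tomboulis2007Confinement] E. T. Tomboulis, Confinement for all values of the coupling in
  four-dimensional SU(2) gauge theory, arXiv:0707.2179, §6 eqs. (6.2)–(6.4), §4 eq. (4.4).
* [Munster1981] G. Münster, High-temperature expansions for the free energy of vortices and the string
  tension in lattice gauge theories, Nucl. Phys. B 180 (1981) 23 (Tomboulis's reference [Mu] for the
  polymer expansion).
-/

noncomputable section

open MeasureTheory Finset Real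
open scoped BigOperators
open Literature.MathematicalPhysics.QuantumLattice

namespace Literature.MathematicalPhysics.QuantumFieldTheory

namespace Tomboulis2007

variable {d L : ℕ}

/-! ### The plaquette character: measurability and boundedness -/

/-- The fundamental character of a plaquette holonomy, `χ_{1/2}(U_p) = tr U_p` (the activity of
arXiv:0707.2179 eq. (6.3) on the one-character ray is `g_p = 2 c_{1/2} χ_{1/2}(U_p)`). [folklore] -/
def plaqChar (U : GaugeConfig d L SU2) (p : Plaquette d L) : ℝ :=
  su2Char 1 (plaquetteHolonomy U p.1 p.2.1.1 p.2.1.2)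

/-- `χ_{1/2}(U_p) = Re tr U_p`: the plaquette character is the plaquette energy `plaqRe` of
`ConstructiveQFTWave0Proofs` for the fundamental representation of `SU(2)` (plumbing). [folklore] -/
private theorem plaqChar_eq_plaqRe (U : GaugeConfig d L SU2) (p : Plaquette d L) :
    plaqChar U p = WilsonRP.plaqRe (fundamentalRep (Fin 2)) U p := by
  simp only [plaqChar, su2Char, WilsonRP.plaqRe, fundamentalRep_apply, Nat.cast_one,
    Polynomial.Chebyshev.U_one, Polynomial.eval_mul, Polynomial.eval_ofNat, Polynomial.eval_X]
  ring

/-- The plaquette character is measurable for the product σ-algebra (plumbing). [folklore] -/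
private theorem measurable_plaqChar (p : Plaquette d L) :
    Measurable fun U : GaugeConfig d L SU2 => plaqChar U p := by
  have h : (fun U : GaugeConfig d L SU2 => plaqChar U p) =
      fun U => WilsonRP.plaqRe (fundamentalRep (Fin 2)) U p :=
    funext fun U => plaqChar_eq_plaqRe U p
  rw [h]
  exact WilsonRP.measurable_plaqRe (fundamentalRep (Fin 2)) (continuous_fundamentalRep (Fin 2)) p

/-- `|χ_{1/2}(U_p)| ≤ 2` (plumbing). [folklore] -/
private theorem abs_plaqChar_le (U : GaugeConfig d L SU2) (p : Plaquette d L) : |plaqChar U p| ≤ 2 := by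
  rw [plaqChar_eq_plaqRe]
  exact_mod_cast WilsonRP.abs_plaqRe_le (fundamentalRep (Fin 2)) (continuous_fundamentalRep (Fin 2)) U p

/-- On the one-character ray the plaquette function is `f(U) = 1 + 2 c_{1/2} χ_{1/2}(U)`
(arXiv:0707.2179 eq. (2.5) with the single coefficient `c_{1/2}`; `d_{1/2} = 2`).
[cite: Tomboulis2007Confinement, §2 eq. (2.5)] -/
theorem plaqFn_one (c : ℕ → ℝ) (W : SU2) : plaqFn 1 c W = 1 + 2 * c 1 * su2Char 1 W := by
  unfold plaqFn
  rw [Finset.Icc_self, Finset.sum_singleton]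
  norm_num

/-- On the one-character ray the twisted plaquette function is `f⁻(U) = 1 - 2 c_{1/2} χ_{1/2}(U)`
(arXiv:0707.2179 eq. (4.4): the half-integer spin changes sign). [cite: Tomboulis2007Confinement, §4 eq. (4.4)] -/
theorem plaqFnTwist_one (c : ℕ → ℝ) (W : SU2) : plaqFnTwist 1 c W = 1 - 2 * c 1 * su2Char 1 W := by
  unfold plaqFnTwist
  rw [Finset.Icc_self, Finset.sum_singleton]
  norm_num
  ring

variable [NeZero L]

/-! ### Haar moments of plaquette sets and the expansion -/

/-- **The Haar moment of a plaquette set** `S`: `I(S) = ∫ ∏_{p ∈ S} χ_{1/2}(U_p) ∏_b dU_b` — the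
unnormalised activity `z(S)` of arXiv:0707.2179 eq. (6.2) on the one-character ray (there for polymers,
i.e. connected `S` without free bonds; here for every `S`, the integral over the bonds outside `S` being
`1`). [cite: Tomboulis2007Confinement, §6 eq. (6.2)] -/
def charMoment (S : Finset (Plaquette d L)) : ℝ :=
  ∫ U, ∏ p ∈ S, plaqChar U p ∂(Measure.pi fun _ : Edge d L => haarProbability SU2)

/-- Products of plaquette characters are Haar integrable (bounded by `2^{|S|}` and measurable)
(plumbing). [folklore] -/
private theorem integrable_prod_plaqChar (S : Finset (Plaquette d L)) :
    Integrable (fun U : GaugeConfig d L SU2 => ∏ p ∈ S, plaqChar U p)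
      (Measure.pi fun _ : Edge d L => haarProbability SU2) := by
  have hmeas : Measurable fun U : GaugeConfig d L SU2 => ∏ p ∈ S, plaqChar U p :=
    Finset.measurable_prod S fun p _ => measurable_plaqChar p
  refine Integrable.of_mem_Icc (-(2 : ℝ) ^ S.card) ((2 : ℝ) ^ S.card) hmeas.aemeasurable
    (ae_of_all _ fun U => ?_)
  have hb : |∏ p ∈ S, plaqChar U p| ≤ (2 : ℝ) ^ S.card := by
    rw [Finset.abs_prod, ← Finset.prod_const]
    exact Finset.prod_le_prod (fun p _ => abs_nonneg _) fun p _ => abs_plaqChar_le U p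
  exact Set.mem_Icc.mpr (abs_le.mp hb)

omit [NeZero L] in
/-- The product of the twist signs over `S` is `(-1)^{|S ∩ V|}` (plumbing). [folklore] -/
private theorem prod_twistSign (V S : Finset (Plaquette d L)) :
    ∏ p ∈ S, (if p ∈ V then (-1 : ℝ) else 1) = (-1 : ℝ) ^ (S ∩ V).card := by
  rw [Finset.prod_ite, Finset.prod_const_one, mul_one, Finset.prod_const, Finset.filter_mem_eq_inter]

/-- **The character expansion of the twisted partition function on the one-character ray**
(arXiv:0707.2179 §6 eqs. (6.2)–(6.4) with the flux replacement (4.4)): for every torus `(ℤ/Lℤ)^d`,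
coefficient sequence `c` (only `c_{1/2} = c 1` enters) and twist set `V`,
`Z⁻_V = Σ_{S ⊆ plaquettes} (2 c_{1/2})^{|S|} (-1)^{|S ∩ V|} I(S)`.
[cite: Tomboulis2007Confinement, §6 eqs. (6.2)–(6.4)] -/
theorem torusZtw_one_eq_sum (c : ℕ → ℝ) (V : Finset (Plaquette d L)) :
    torusZtw d L 1 c V = ∑ S ∈ (Finset.univ : Finset (Plaquette d L)).powerset,
      (2 * c 1) ^ S.card * (-1 : ℝ) ^ (S ∩ V).card * charMoment S := by
  -- pointwise expansion of the integrand
  have hpt : ∀ U : GaugeConfig d L SU2,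
      (∏ p : Plaquette d L, (if p ∈ V then plaqFnTwist 1 c (plaquetteHolonomy U p.1 p.2.1.1 p.2.1.2)
        else plaqFn 1 c (plaquetteHolonomy U p.1 p.2.1.1 p.2.1.2))) =
      ∑ S ∈ (Finset.univ : Finset (Plaquette d L)).powerset,
        ((2 * c 1) ^ S.card * (-1 : ℝ) ^ (S ∩ V).card) * ∏ p ∈ S, plaqChar U p := by
    intro U
    have h1 : (∏ p : Plaquette d L, (if p ∈ V then plaqFnTwist 1 c (plaquetteHolonomy U p.1 p.2.1.1 p.2.1.2)
        else plaqFn 1 c (plaquetteHolonomy U p.1 p.2.1.1 p.2.1.2))) =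
        ∏ p : Plaquette d L, (1 + (if p ∈ V then (-1 : ℝ) else 1) * (2 * c 1) * plaqChar U p) := by
      refine Finset.prod_congr rfl fun p _ => ?_
      unfold plaqChar
      split_ifs
      · rw [plaqFnTwist_one]; ring
      · rw [plaqFn_one]; ring
    rw [h1, Finset.prod_one_add]
    refine Finset.sum_congr rfl fun S _ => ?_
    rw [Finset.prod_mul_distrib, Finset.prod_mul_distrib, prod_twistSign, Finset.prod_const]
    ring
  unfold torusZtw
  simp_rw [hpt]
  rw [integral_finsetSum _ (fun S _ => (integrable_prod_plaqChar S).const_mul _)]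
  refine Finset.sum_congr rfl fun S _ => ?_
  rw [integral_const_mul]
  rfl

/-- **The character expansion of the untwisted partition function on the one-character ray**:
`Z = Σ_{S ⊆ plaquettes} (2 c_{1/2})^{|S|} I(S)`. [cite: Tomboulis2007Confinement, §6 eqs. (6.2)–(6.4)] -/
theorem torusZ_one_eq_sum (c : ℕ → ℝ) :
    torusZ d L 1 c = ∑ S ∈ (Finset.univ : Finset (Plaquette d L)).powerset,
      (2 * c 1) ^ S.card * charMoment S := by
  rw [← torusZtw_empty d L 1 c, torusZtw_one_eq_sum]
  refine Finset.sum_congr rfl fun S _ => ?_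
  rw [Finset.inter_empty, Finset.card_empty, pow_zero, mul_one]

/-- **The top-coefficient sign rule** (census parity law, identity (P4)): the full support `S = Λ` (all
`F` plaquettes) carries the twist sign `(-1)^{|V|}`, so `Z⁻_V - (-1)^{|V|} Z` is a combination of the
moments of the PROPER plaquette sets only — as a polynomial in `c_{1/2}` it has degree `< F`, i.e. the
coefficients of `c_{1/2}^F` in `Z⁻_V` and `Z` agree up to the sign `(-1)^{|V|}` (from arXiv:0707.2179
§6 (6.2)–(6.4) with the replacement (4.4)). [cite: Tomboulis2007Confinement, §6 eqs. (6.2)–(6.4)] -/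
theorem torusZtw_one_sub_sign_mul_torusZ (c : ℕ → ℝ) (V : Finset (Plaquette d L)) :
    torusZtw d L 1 c V - (-1 : ℝ) ^ V.card * torusZ d L 1 c =
      ∑ S ∈ ((Finset.univ : Finset (Plaquette d L)).powerset).erase Finset.univ,
        (2 * c 1) ^ S.card * ((-1 : ℝ) ^ (S ∩ V).card - (-1 : ℝ) ^ V.card) * charMoment S := by
  rw [torusZtw_one_eq_sum, torusZ_one_eq_sum, Finset.mul_sum, ← Finset.sum_sub_distrib]
  have hmem : (Finset.univ : Finset (Plaquette d L)) ∈ (Finset.univ : Finset (Plaquette d L)).powerset :=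
    Finset.mem_powerset.mpr le_rfl
  rw [← Finset.add_sum_erase _ _ hmem]
  have h0 : (2 * c 1) ^ (Finset.univ : Finset (Plaquette d L)).card *
        (-1 : ℝ) ^ ((Finset.univ : Finset (Plaquette d L)) ∩ V).card *
          charMoment (Finset.univ : Finset (Plaquette d L)) -
      (-1 : ℝ) ^ V.card * ((2 * c 1) ^ (Finset.univ : Finset (Plaquette d L)).card *
        charMoment (Finset.univ : Finset (Plaquette d L))) = 0 := by
    rw [Finset.univ_inter]; ring
  rw [h0, zero_add]
  exact Finset.sum_congr rfl fun S _ => by ring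

/-- The same on the interpolation ray `c̃ = α • c`: only `c 1` matters and it scales by `α`, so
`Z⁻_V(α) = Σ_S (2 α c_{1/2})^{|S|} (-1)^{|S ∩ V|} I(S)` is a polynomial of degree `≤ F` in `α` whose top
coefficient is `(-1)^{|V|}` times that of `Z(α)`. [cite: Tomboulis2007Confinement, §6 eqs. (6.2)–(6.4)] -/
theorem torusZtw_one_scaleCoeff_eq_sum (c : ℕ → ℝ) (α : ℝ) (V : Finset (Plaquette d L)) :
    torusZtw d L 1 (scaleCoeff α c) V = ∑ S ∈ (Finset.univ : Finset (Plaquette d L)).powerset,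
      (2 * (α * c 1)) ^ S.card * (-1 : ℝ) ^ (S ∩ V).card * charMoment S :=
  torusZtw_one_eq_sum (scaleCoeff α c) V

/-! ### Haar moments vanish off the mod-2 cycles

The change of variables `U_b ↦ -U_b` (`flipLinks E`, `VortexTwistCohomology.lean`) multiplies
`∏_{p ∈ S} χ_{1/2}(U_p)` by `(-1)^{|S ∩ δE|}`; Haar invariance then forces `I(S) = 0` whenever `S` meets
some coboundary `δE` in an odd number of plaquettes — i.e. unless `S` is a mod-2 CYCLE (orthogonal to all
coboundaries; with `E` a single bond: every bond lies in an even number of plaquettes of `S`, in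
particular `S` has no free bond). This is the support rule of the character expansion: only closed
surfaces contribute (Drouffe–Zuber / Balian–Drouffe–Itzykson "closed diagrams"; Tomboulis's polymers
"containing no free bond", arXiv:0707.2179 §6 before (6.2)); the exact census engines enumerate exactly
these supports. -/

omit [NeZero L] in
/-- `σ_E(e) = (-1)^{𝟙_E(e)}` (local copy of the plumbing in `VortexTwistCohomology`). [folklore] -/
private theorem linkSign_eq_pow' (E : Finset (Edge d L)) (e : Edge d L) :
    linkSign E e = negOne ^ linkInd E e := by
  unfold linkSign linkInd
  split_ifs <;> simp

omit [NeZero L] in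
/-- The plaquette sign is `(-1)^{k_p(E)}` (local copy). [folklore] -/
private theorem plaqSign_eq_pow' (E : Finset (Edge d L)) (x : Site d L) (i j : Fin d) :
    plaqSign E x i j = negOne ^ flipCount E x i j := by
  simp only [plaqSign, flipCount, linkSign_eq_pow', pow_add]

omit [NeZero L] in
/-- `χ_{1/2}((-𝟙)^k W) = (-1)^k χ_{1/2}(W)` (plumbing). [folklore] -/
private theorem su2Char_one_negOne_pow_mul (k : ℕ) (W : SU2) :
    su2Char 1 (negOne ^ k * W) = (-1 : ℝ) ^ k * su2Char 1 W := by
  induction k generalizing W with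
  | zero => simp
  | succ k ih =>
    rw [pow_succ, mul_assoc, ih (negOne * W), su2Char_negOne_mul, pow_succ]
    ring

/-- **Flipping the bonds of `E` multiplies the support product by `(-1)^{|S ∩ δE|}`.**
[cite: Tomboulis2007Confinement, §4 (text after eq. (4.1))] -/
theorem prod_plaqChar_flipLinks (E : Finset (Edge d L)) (S : Finset (Plaquette d L))
    (U : GaugeConfig d L SU2) :
    ∏ p ∈ S, plaqChar (flipLinks E U) p =
      (-1 : ℝ) ^ (S ∩ coboundary E).card * ∏ p ∈ S, plaqChar U p := by
  have hp : ∀ p ∈ S, plaqChar (flipLinks E U) p =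
      (if p ∈ coboundary E then (-1 : ℝ) else 1) * plaqChar U p := by
    intro p _
    unfold plaqChar
    rw [plaquetteHolonomy_flipLinks, plaqSign_eq_pow', su2Char_one_negOne_pow_mul]
    by_cases h : p ∈ coboundary E
    · rw [if_pos h, ((mem_coboundary E p).mp h).neg_one_pow]
    · rw [if_neg h, (Nat.not_odd_iff_even.mp (fun h' => h ((mem_coboundary E p).mpr h'))).neg_one_pow]
  rw [Finset.prod_congr rfl hp, Finset.prod_mul_distrib, prod_twistSign, mul_comm]

/-- **Support rule of the character expansion: Haar moments vanish off the mod-2 cycles.** If the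
plaquette set `S` meets the coboundary `δE` of some bond set `E` in an ODD number of plaquettes, then
`I(S) = ∫ ∏_{p∈S} χ_{1/2}(U_p) ∏ dU = 0` (substitute `U_b ↦ -U_b` on `E`: the integrand changes sign, the
Haar measure does not). Equivalently `I(S) ≠ 0` only if `S` is a mod-2 cycle; with `E = {b}`: every bond
lies in an even number of plaquettes of `S` — Tomboulis's polymers "containing no free bond"
(arXiv:0707.2179 §6, before (6.2)), the closed surfaces of the strong-coupling diagrams.
[cite: Tomboulis2007Confinement, §6 (text before eq. (6.2))] -/
theorem charMoment_eq_zero_of_odd_inter_coboundary (S : Finset (Plaquette d L)) (E : Finset (Edge d L))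
    (h : Odd (S ∩ coboundary E).card) : charMoment S = 0 := by
  have hmp : MeasurePreserving (flipEquiv E)
      (Measure.pi fun _ : Edge d L => haarProbability SU2)
      (Measure.pi fun _ : Edge d L => haarProbability SU2) :=
    measurePreserving_flipLinks E
  have h1 : charMoment S = (-1 : ℝ) ^ (S ∩ coboundary E).card * charMoment S := by
    unfold charMoment
    calc ∫ U, ∏ p ∈ S, plaqChar U p ∂(Measure.pi fun _ : Edge d L => haarProbability SU2)
        = ∫ U, ∏ p ∈ S, plaqChar (flipLinks E U) p ∂(Measure.pi fun _ : Edge d L => haarProbability SU2) :=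
          (hmp.integral_comp' (fun U : GaugeConfig d L SU2 => ∏ p ∈ S, plaqChar U p)).symm
      _ = ∫ U, (-1 : ℝ) ^ (S ∩ coboundary E).card * ∏ p ∈ S, plaqChar U p
            ∂(Measure.pi fun _ : Edge d L => haarProbability SU2) := by
          congr 1
          funext U
          exact prod_plaqChar_flipLinks E S U
      _ = (-1 : ℝ) ^ (S ∩ coboundary E).card *
            ∫ U, ∏ p ∈ S, plaqChar U p ∂(Measure.pi fun _ : Edge d L => haarProbability SU2) :=
          integral_const_mul _ _
  rw [h.neg_one_pow] at h1
  linarith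

/-- **The supports of the expansion are mod-2 cycles**: if `I(S) ≠ 0` then `S` meets EVERY coboundary
in an even number of plaquettes. [cite: Tomboulis2007Confinement, §6 (text before eq. (6.2))] -/
theorem even_inter_coboundary_of_charMoment_ne_zero {S : Finset (Plaquette d L)} (hS : charMoment S ≠ 0)
    (E : Finset (Edge d L)) : Even (S ∩ coboundary E).card := by
  by_contra h
  exact hS (charMoment_eq_zero_of_odd_inter_coboundary S E (Nat.not_even_iff_odd.mp h))

end Tomboulis2007

end Literature.MathematicalPhysics.QuantumFieldTheory

end
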